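import Literature.AlgebraicGeometry.Frobenioids.PerfectionCoAngularDivisors
import Literature.AlgebraicGeometry.Frobenioids.PreFrobenioidDataToFunctor
import Literature.AlgebraicGeometry.Frobenioids.BiratGerms
import HarnessLib

/-!
# Frobenioids I, Proposition 3.2 (iii) "`C^pf` is a Frobenioid": Definition 1.3 (iii)(d), slice half, for
# the perfection — the elements `(ψ^*)⁻¹ Div ψ` of co-angular pre-steps into an object of `C^pf` (PROOFS)

Mochizuki, *The geometry of Frobenioids I: the general theory*, Kyushu J. Math. **62** (2008)
293–400, Definition 1.3 (iii)(d) p. 24 ("the natural functor `(C^coa-pre)_A → Order(Φ(A))^opp` … [by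
assigning to an arrow `ψ : B → A` the element `(ψ^*)⁻¹(Div(ψ)) ∈ Φ(A)`] is an equivalence of categories"),
Proposition 3.2 (iii) p. 59 [cite: MochizukiFrdI2008, Prop. 3.2 (iii) p.59].

PROOF-ONLY sequel of `PerfectionCoAngularDivisors.lean` (row `FrdI:Prop3.2(iii)-frobenioid`, Def. 1.3 (iii)
pieces, seat abc-iut-w5-d246), for `C` of Frobenius-isotropic type.  The element `(ψ^*)⁻¹ Div ψ` has no
data-level name in the cell's interface `PreFrobenioidData`, so — as agreed for the assembly of
`IsFrobenioid (Perfection.ops hF).toFunctor` (seat abc-iut-L1-d1, `PreFrobenioidDataToFunctor.lean`) — the two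
clauses are stated FUNCTOR-LEVEL against the structure functor `(Perfection.ops hF).toFunctor : C^pf → F_{Φ^pf}`,
in the exact shape of the fields `iii_d_over_surj` / `iii_d_over_full` of the cell's `IsFrobenioid`:

* `invDiv_mk`: for a class `ψ = [s]`, `s : B^{(a)} → A^{(b)}` a base-isomorphism of `C`,
  `(ψ^*)⁻¹ Div ψ = ((frob_{A,b})^* ((s^*)⁻¹ Div s))^{1/(m·a)} ∈ Φ(Base A)^pf`;
* `iii_d_over_surj_perfection`: every element of `Φ^pf(Base X)` is `(ψ^*)⁻¹ Div ψ` for a co-angular pre-step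
  `ψ` into `X` (Def. 1.3 (iii)(d) of `C` at `A^{(N)}`, pre-composed with the inverse of the degree-one arrow
  `B → B^{(1)}`);
* `iii_d_over_full_perfection`: `(ψ'^*)⁻¹ Div ψ' ∣ (ψ^*)⁻¹ Div ψ` lifts to a co-angular pre-step `g` with
  `g ≫ ψ' = ψ` (reusing `pull_injective`, `RatFrac.invDiv_congr` of the birationalization files) — the two representatives are transported to a common TARGET exponent and then up by the
  factor `T` unwinding the divisibility of perfected elements (`exists_pow_dvd_pow_of_mk_dvd_mk`); under
  transport `(ψ^*)⁻¹ Div ψ` is raised to the degree of the transition (`pull_frob_invDiv_lift`, Prop. 1.10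
  (i)); Def. 1.3 (iii)(d) of `C` then applies (domains isotropic).
No new definitions; nothing here is specific to the abc programme.
-/

namespace Literature.AlgebraicGeometry.Frobenioids

namespace PreFrobenioid

namespace Perfection

open CategoryTheory Opposite

universe w v v' u u'

variable {D : Type u} [Category.{v} D] {Φ : Dᵒᵖ ⥤ CommMonCat.{w}}
  {C : Type u'} [Category.{v'} C] {F : C ⥤ ElemFrobenioid Φ} {hF : IsFrobenioid F}

/-! ### `(ψ^*)⁻¹ Div ψ`: characterization, invariance under isomorphisms at the source, classes -/

/-- `(ψ^*)⁻¹ Div ψ` is THE element pulling back to `Div ψ` along `Base ψ`.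
[cite: MochizukiFrdI2008, Def. 1.3 (iii) p.24] -/
theorem invDiv_eq_of_pull_eq {B A : C} (ψ : B ⟶ A) (h : IsBaseIso F ψ)
    {x : Φ.obj (op (baseObj F A))} (hx : pull Φ (Base F ψ) x = Div F ψ) : invDiv F ψ h = x := by
  haveI : IsIso (Base F ψ) := h
  unfold invDiv
  rw [← hx, ← pull_comp, IsIso.inv_hom_id, pull_id]

/-- `(ψ^*)⁻¹ Div ψ` is unchanged by pre-composition with an isomorphism.
[cite: MochizukiFrdI2008, Def. 1.3 (iii) p.24] -/
theorem invDiv_iso_comp (hP : IsPreFrobenioid Φ F) {B' B A : C} (i : B' ⟶ B) [IsIso i] (σ : B ⟶ A)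
    (hσ : IsBaseIso F σ) (h : IsBaseIso F (i ≫ σ)) : invDiv F (i ≫ σ) h = invDiv F σ hσ := by
  apply invDiv_eq_of_pull_eq
  rw [base_comp, pull_comp, pull_invDiv, div_comp,
    show Div F i = 1 from isIsometry_of_isIso F hP i, one_pow, mul_one]

/-- **`(ψ^*)⁻¹ Div ψ` of a class of `C^pf`**: for `ψ = [s] : (B, m) → (A, n)`, `s : B^{(a)} → A^{(b)}` a
base-isomorphism of `C`, the element `(ψ^*)⁻¹ Div ψ ∈ Φ(Base A)^pf` (for the structure functor
`(Perfection.ops hF).toFunctor`) is `((frob_{A,b})^* ((s^*)⁻¹ Div s))^{1/(m·a)}`.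
[cite: MochizukiFrdI2008, Prop. 3.2 (i) p.58] -/
theorem invDiv_mk {Y X : Perfection hF} (s : Rep Y X) (hs : IsBaseIso F s.hom)
    (h : IsBaseIso (ops hF).toFunctor (Hom.mk s : Y ⟶ X)) :
    invDiv (ops hF).toFunctor (Hom.mk s : Y ⟶ X) h =
      Frobenioids.Perfection.mk (pull Φ (Base F (frob hF X.obj s.L.b)) (invDiv F s.hom hs)) (Y.idx * s.L.a) := by
  haveI : IsIso (Base F s.hom) := hs
  haveI hb : IsIso s.baseMap := h
  change Frobenioids.Perfection.map (pull Φ (inv s.baseMap))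
      (Frobenioids.Perfection.mk (pull Φ (Base F (frob hF Y.obj s.L.a)) (Div F s.hom)) (Y.idx * s.L.a)) = _
  rw [Frobenioids.Perfection.map_mk, ← pull_comp]
  have key : inv s.baseMap ≫ Base F (frob hF Y.obj s.L.a) = Base F (frob hF X.obj s.L.b) ≫ inv (Base F s.hom) := by
    rw [IsIso.inv_comp_eq]
    unfold Rep.baseMap
    simp only [Category.assoc, baseInvFrob_base_frob_assoc, IsIso.hom_inv_id, Category.comp_id]
  rw [key, pull_comp]
  rfl

/-- Under transport to a higher level the (pulled-back) element `(s^*)⁻¹ Div s` of a base-isomorphic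
representative is raised to the degree of the transition (Prop. 1.10 (i)).
[cite: MochizukiFrdI2008, Prop. 1.10 (i) p.34] -/
theorem pull_frob_invDiv_lift {Y X : Perfection hF} (s : Rep Y X) (hs : IsBaseIso F s.hom) (L : Level Y X)
    (h : s.L.LE L) (hs' : IsBaseIso F (Level.lift s.L L h s.hom)) :
    pull Φ (Base F (frob hF X.obj L.b)) (invDiv F (Level.lift s.L L h s.hom) hs') =
      pull Φ (Base F (frob hF X.obj s.L.b)) (invDiv F s.hom hs) ^
        (PreFrobenioid.degFr F (frobTrans hF X.obj h.2) : ℕ) := by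
  have hα := isFrobeniusType_frobTrans hF Y.obj h.1
  have hβ := isFrobeniusType_frobTrans hF X.obj h.2
  haveI : IsIso (Base F (frobTrans hF Y.obj h.1)) := hα.2
  haveI : IsIso (Base F s.hom) := hs
  haveI : IsIso (Base F (Level.lift s.L L h s.hom)) := hs'
  haveI := isIso_base_frob hF X.obj L.b
  haveI : IsIso (baseInvFrob hF X.obj L.b) := by unfold baseInvFrob; infer_instance
  have sq := Level.lift_spec s.L L h s.hom
  -- compare after the injective pull-back along `Base(s') ≫ Base(frob_{A,b'})⁻¹`
  apply pull_injective (Base F (Level.lift s.L L h s.hom) ≫ baseInvFrob hF X.obj L.b)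
  have key : (Base F (Level.lift s.L L h s.hom) ≫ baseInvFrob hF X.obj L.b) ≫ Base F (frob hF X.obj s.L.b) =
      inv (Base F (frobTrans hF Y.obj h.1)) ≫ Base F s.hom := by
    rw [IsIso.eq_inv_comp, ← Category.assoc, ← Category.assoc, ← base_comp, sq, base_comp, base_frobTrans]
    simp only [Category.assoc, base_frob_baseInvFrob_assoc, baseInvFrob_base_frob, Category.comp_id]
  rw [← pull_comp, Category.assoc, baseInvFrob_base_frob, Category.comp_id, pull_invDiv, map_pow,
    ← pull_comp, key, pull_comp, pull_invDiv]
  exact div_frobeniusConjugate sq hα hβ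

/-! ### Definition 1.3 (iii)(d), slice, essential surjectivity -/

/-- **Def. 1.3 (iii)(d) for `C^pf`, slice, essentially surjective** (for `C` of Frobenius-isotropic type;
functor-level, for the structure functor `(Perfection.ops hF).toFunctor`): every element of `Φ^pf(Base X)`
is `(ψ^*)⁻¹ Div ψ` for a co-angular pre-step `ψ` of `C^pf` into `X`.
[cite: MochizukiFrdI2008, Prop. 3.2 (iii) p.59] -/
theorem iii_d_over_surj_perfection (hiso : IsOfType (IsFrobeniusIsotropic F)) (X : Perfection hF)
    (x : (ops hF).monFunctor.obj (op (baseObj (ops hF).toFunctor X))) :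
    ∃ (Y : Perfection hF) (ψ : Y ⟶ X) (h : IsCoAngularPreStep (ops hF).toFunctor ψ),
      invDiv (ops hF).toFunctor ψ h.2.2 = x := by
  change Frobenioids.Perfection (Φ.obj (op (baseObj F X.obj))) at x
  obtain ⟨⟨y, N⟩, rfl⟩ := Frobenioids.Perfection.mk_surjective x
  haveI := isIso_base_frob hF X.obj N
  -- a co-angular pre-step of `C` into `A^{(N)}` with the prescribed `(σ^*)⁻¹ Div σ`
  obtain ⟨B, σ, hσ, hinv⟩ := hF.iii_d_over_surj (frobPow hF X.obj N)
    (pull Φ (inv (Base F (frob hF X.obj N))) (y ^ (X.idx : ℕ)))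
  haveI := isIso_frob_one (hF := hF) B
  -- its class `(B, n·N) → (A, n)` at the level `(1, N)`
  let Y : Perfection hF := ⟨B, X.idx * N⟩
  have hlev : Y.idx * 1 = X.idx * N := mul_one _
  have hτ : IsPreStep F (inv (frob hF B 1) ≫ σ) :=
    IsPreStep.comp F (PreFrobenioid.isPreStep_of_isIso F (inv (frob hF B 1))) hσ.2
  have hψ : IsCoAngularPreStep (ops hF).toFunctor
      (Hom.mk (⟨⟨1, N, hlev⟩, inv (frob hF B 1) ≫ σ⟩ : Rep Y X) : Y ⟶ X) :=
    ⟨(PreFrobenioidData.ofFunctor_isCoAngular (ops hF).toFunctor _).mp (isCoAngular_of_frobeniusIsotropic hiso _),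
      (PreFrobenioidData.isPreStep_toFunctor_iff (ops hF) _).mpr
        ((isPreStep_mk_iff (⟨⟨1, N, hlev⟩, _⟩ : Rep Y X)).mpr hτ)⟩
  refine ⟨Y, Hom.mk ⟨⟨1, N, hlev⟩, inv (frob hF B 1) ≫ σ⟩, hψ, ?_⟩
  rw [invDiv_mk (⟨⟨1, N, hlev⟩, _⟩ : Rep Y X) hτ.2 hψ.2.2]
  change Frobenioids.Perfection.mk (pull Φ (Base F (frob hF X.obj N)) (invDiv F (inv (frob hF B 1) ≫ σ) hτ.2))
      (X.idx * N * 1) = Frobenioids.Perfection.mk y N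
  rw [invDiv_iso_comp hF.isPreFrobenioid (inv (frob hF B 1)) σ hσ.2.2, hinv, ← pull_comp, IsIso.hom_inv_id, pull_id,
    mul_one, mul_comm X.idx N, Frobenioids.Perfection.mk_pow_mul]

/-! ### Definition 1.3 (iii)(d), slice, fullness -/

/-- **Def. 1.3 (iii)(d) for `C^pf`, slice, full** (for `C` of Frobenius-isotropic type; functor-level, for the
structure functor `(Perfection.ops hF).toFunctor`): for co-angular pre-steps `ψ : Y → X`, `ψ' : Y' → X` of
`C^pf` with `(ψ'^*)⁻¹ Div ψ' ∣ (ψ^*)⁻¹ Div ψ` there is a co-angular pre-step `g : Y → Y'` with `g ≫ ψ' = ψ`.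
[cite: MochizukiFrdI2008, Prop. 3.2 (iii) p.59] -/
theorem iii_d_over_full_perfection (hiso : IsOfType (IsFrobeniusIsotropic F)) ⦃X Y Y' : Perfection hF⦄
    (ψ : Y ⟶ X) (ψ' : Y' ⟶ X) (hψ : IsCoAngularPreStep (ops hF).toFunctor ψ)
    (hψ' : IsCoAngularPreStep (ops hF).toFunctor ψ')
    (hdvd : invDiv (ops hF).toFunctor ψ' hψ'.2.2 ∣ invDiv (ops hF).toFunctor ψ hψ.2.2) :
    ∃ g : Y ⟶ Y', IsCoAngularPreStep (ops hF).toFunctor g ∧ g ≫ ψ' = ψ := by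
  obtain ⟨⟨⟨a₁, b₁, hab₁⟩, s₁⟩, rfl⟩ := Hom.mk_surjective ψ
  obtain ⟨⟨⟨a₂, b₂, hab₂⟩, s₂⟩, rfl⟩ := Hom.mk_surjective ψ'
  have hs₁ : IsPreStep F s₁ := (isPreStep_mk_iff (⟨⟨a₁, b₁, hab₁⟩, s₁⟩ : Rep Y X)).mp
    ((PreFrobenioidData.isPreStep_toFunctor_iff (ops hF) _).mp hψ.2)
  have hs₂ : IsPreStep F s₂ := (isPreStep_mk_iff (⟨⟨a₂, b₂, hab₂⟩, s₂⟩ : Rep Y' X)).mp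
    ((PreFrobenioidData.isPreStep_toFunctor_iff (ops hF) _).mp hψ'.2)
  obtain ⟨B₁', φ₁, hφ₁, hB₁'⟩ := hiso Y.obj
  obtain ⟨B₂', φ₂, hφ₂, hB₂'⟩ := hiso Y'.obj
  -- STEP 1: a common TARGET exponent `E = b₁·b₂·(d₁·d₂)`, source exponents `S₁ = a₁·b₂·(d₁·d₂)`,
  -- `S₂ = a₂·b₁·(d₁·d₂)`
  have hE₁ : Y.idx * (a₁ * b₂ * (PreFrobenioid.degFr F φ₁ * PreFrobenioid.degFr F φ₂)) =
      X.idx * (b₁ * b₂ * (PreFrobenioid.degFr F φ₁ * PreFrobenioid.degFr F φ₂)) :=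
    calc Y.idx * (a₁ * b₂ * (PreFrobenioid.degFr F φ₁ * PreFrobenioid.degFr F φ₂))
          = Y.idx * a₁ * (b₂ * (PreFrobenioid.degFr F φ₁ * PreFrobenioid.degFr F φ₂)) := by ac_rfl
      _ = X.idx * b₁ * (b₂ * (PreFrobenioid.degFr F φ₁ * PreFrobenioid.degFr F φ₂)) := by rw [hab₁]
      _ = X.idx * (b₁ * b₂ * (PreFrobenioid.degFr F φ₁ * PreFrobenioid.degFr F φ₂)) := by ac_rfl
  have hE₂ : Y'.idx * (a₂ * b₁ * (PreFrobenioid.degFr F φ₁ * PreFrobenioid.degFr F φ₂)) =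
      X.idx * (b₁ * b₂ * (PreFrobenioid.degFr F φ₁ * PreFrobenioid.degFr F φ₂)) :=
    calc Y'.idx * (a₂ * b₁ * (PreFrobenioid.degFr F φ₁ * PreFrobenioid.degFr F φ₂))
          = Y'.idx * a₂ * (b₁ * (PreFrobenioid.degFr F φ₁ * PreFrobenioid.degFr F φ₂)) := by ac_rfl
      _ = X.idx * b₂ * (b₁ * (PreFrobenioid.degFr F φ₁ * PreFrobenioid.degFr F φ₂)) := by rw [hab₂]
      _ = X.idx * (b₁ * b₂ * (PreFrobenioid.degFr F φ₁ * PreFrobenioid.degFr F φ₂)) := by ac_rfl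
  have hd₁ : PreFrobenioid.degFr F φ₁ ∣ a₁ * b₂ * (PreFrobenioid.degFr F φ₁ * PreFrobenioid.degFr F φ₂) :=
    (dvd_mul_right _ _).mul_left _
  have hd₂ : PreFrobenioid.degFr F φ₂ ∣ a₂ * b₁ * (PreFrobenioid.degFr F φ₁ * PreFrobenioid.degFr F φ₂) :=
    (dvd_mul_left _ _).mul_left _
  have h₁E : Level.LE (⟨a₁, b₁, hab₁⟩ : Level Y X) ⟨_, _, hE₁⟩ :=
    ⟨(dvd_mul_right a₁ b₂).mul_right _, (dvd_mul_right b₁ b₂).mul_right _⟩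
  have h₂E : Level.LE (⟨a₂, b₂, hab₂⟩ : Level Y' X) ⟨_, _, hE₂⟩ :=
    ⟨(dvd_mul_right a₂ b₁).mul_right _, (dvd_mul_left b₂ b₁).mul_right _⟩
  generalize b₁ * b₂ * (PreFrobenioid.degFr F φ₁ * PreFrobenioid.degFr F φ₂) = E at hE₁ hE₂ h₁E h₂E
  generalize a₁ * b₂ * (PreFrobenioid.degFr F φ₁ * PreFrobenioid.degFr F φ₂) = S₁ at hE₁ h₁E hd₁
  generalize a₂ * b₁ * (PreFrobenioid.degFr F φ₁ * PreFrobenioid.degFr F φ₂) = S₂ at hE₂ h₂E hd₂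
  have hR₁ : IsPreStep F (Level.lift (⟨a₁, b₁, hab₁⟩ : Level Y X) ⟨S₁, E, hE₁⟩ h₁E s₁) :=
    (isPreStep_lift_iff (⟨⟨a₁, b₁, hab₁⟩, s₁⟩ : Rep Y X) _ h₁E).mpr hs₁
  have hR₂ : IsPreStep F (Level.lift (⟨a₂, b₂, hab₂⟩ : Level Y' X) ⟨S₂, E, hE₂⟩ h₂E s₂) :=
    (isPreStep_lift_iff (⟨⟨a₂, b₂, hab₂⟩, s₂⟩ : Rep Y' X) _ h₂E).mpr hs₂
  -- the hypotheses at the aligned level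
  have hψ₁E : IsBaseIso (ops hF).toFunctor
      (Hom.mk (⟨⟨S₁, E, hE₁⟩, Level.lift (⟨a₁, b₁, hab₁⟩ : Level Y X) ⟨S₁, E, hE₁⟩ h₁E s₁⟩ : Rep Y X) : Y ⟶ X) := by
    rw [Hom.mk_lift (⟨⟨a₁, b₁, hab₁⟩, s₁⟩ : Rep Y X) ⟨S₁, E, hE₁⟩ h₁E]; exact hψ.2.2
  have hψ₂E : IsBaseIso (ops hF).toFunctor
      (Hom.mk (⟨⟨S₂, E, hE₂⟩, Level.lift (⟨a₂, b₂, hab₂⟩ : Level Y' X) ⟨S₂, E, hE₂⟩ h₂E s₂⟩ : Rep Y' X) : Y' ⟶ X) := by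
    rw [Hom.mk_lift (⟨⟨a₂, b₂, hab₂⟩, s₂⟩ : Rep Y' X) ⟨S₂, E, hE₂⟩ h₂E]; exact hψ'.2.2
  have hdvd' : invDiv (ops hF).toFunctor _ hψ₂E ∣ invDiv (ops hF).toFunctor _ hψ₁E := by
    rw [RatFrac.invDiv_congr (F := (ops hF).toFunctor)
        (Hom.mk_lift (⟨⟨a₁, b₁, hab₁⟩, s₁⟩ : Rep Y X) ⟨S₁, E, hE₁⟩ h₁E) hψ₁E hψ.2.2,
      RatFrac.invDiv_congr (F := (ops hF).toFunctor)
        (Hom.mk_lift (⟨⟨a₂, b₂, hab₂⟩, s₂⟩ : Rep Y' X) ⟨S₂, E, hE₂⟩ h₂E) hψ₂E hψ'.2.2]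
    exact hdvd
  rw [← Hom.mk_lift (⟨⟨a₁, b₁, hab₁⟩, s₁⟩ : Rep Y X) ⟨S₁, E, hE₁⟩ h₁E,
    ← Hom.mk_lift (⟨⟨a₂, b₂, hab₂⟩, s₂⟩ : Rep Y' X) ⟨S₂, E, hE₂⟩ h₂E]
  generalize Level.lift (⟨a₁, b₁, hab₁⟩ : Level Y X) ⟨S₁, E, hE₁⟩ h₁E s₁ = R₁ at hR₁ hψ₁E hdvd' ⊢
  generalize Level.lift (⟨a₂, b₂, hab₂⟩ : Level Y' X) ⟨S₂, E, hE₂⟩ h₂E s₂ = R₂ at hR₂ hψ₂E hdvd' ⊢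
  -- STEP 2: unwind the divisibility to `z₂^T ∣ z₁^T`
  rw [invDiv_mk (⟨⟨S₁, E, hE₁⟩, R₁⟩ : Rep Y X) hR₁.2 hψ₁E, invDiv_mk (⟨⟨S₂, E, hE₂⟩, R₂⟩ : Rep Y' X) hR₂.2 hψ₂E]
    at hdvd'
  change Frobenioids.Perfection.mk (pull Φ (Base F (frob hF X.obj E)) (invDiv F R₂ hR₂.2)) (Y'.idx * S₂) ∣
    Frobenioids.Perfection.mk (pull Φ (Base F (frob hF X.obj E)) (invDiv F R₁ hR₁.2)) (Y.idx * S₁) at hdvd'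
  rw [hE₁, hE₂] at hdvd'
  obtain ⟨T, hT⟩ := Frobenioids.Perfection.exists_pow_dvd_pow_of_mk_dvd_mk hdvd'
  -- STEP 3: go up by `T`
  have hET₁ : Y.idx * (S₁ * T) = X.idx * (E * T) := by rw [← mul_assoc, hE₁, mul_assoc]
  have hET₂ : Y'.idx * (S₂ * T) = X.idx * (E * T) := by rw [← mul_assoc, hE₂, mul_assoc]
  have h₁T : Level.LE (⟨S₁, E, hE₁⟩ : Level Y X) ⟨S₁ * T, E * T, hET₁⟩ := ⟨dvd_mul_right _ _, dvd_mul_right _ _⟩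
  have h₂T : Level.LE (⟨S₂, E, hE₂⟩ : Level Y' X) ⟨S₂ * T, E * T, hET₂⟩ := ⟨dvd_mul_right _ _, dvd_mul_right _ _⟩
  have hR₁T : IsPreStep F (Level.lift (⟨S₁, E, hE₁⟩ : Level Y X) ⟨S₁ * T, E * T, hET₁⟩ h₁T R₁) :=
    (isPreStep_lift_iff (⟨⟨S₁, E, hE₁⟩, R₁⟩ : Rep Y X) _ h₁T).mpr hR₁
  have hR₂T : IsPreStep F (Level.lift (⟨S₂, E, hE₂⟩ : Level Y' X) ⟨S₂ * T, E * T, hET₂⟩ h₂T R₂) :=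
    (isPreStep_lift_iff (⟨⟨S₂, E, hE₂⟩, R₂⟩ : Rep Y' X) _ h₂T).mpr hR₂
  have hinv₁ := pull_frob_invDiv_lift (⟨⟨S₁, E, hE₁⟩, R₁⟩ : Rep Y X) hR₁.2 ⟨S₁ * T, E * T, hET₁⟩ h₁T hR₁T.2
  have hinv₂ := pull_frob_invDiv_lift (⟨⟨S₂, E, hE₂⟩, R₂⟩ : Rep Y' X) hR₂.2 ⟨S₂ * T, E * T, hET₂⟩ h₂T hR₂T.2
  rw [degFr_frobTrans_mul] at hinv₁ hinv₂
  change pull Φ (Base F (frob hF X.obj (E * T))) (invDiv F (Level.lift _ _ h₁T R₁) hR₁T.2) =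
    pull Φ (Base F (frob hF X.obj E)) (invDiv F R₁ hR₁.2) ^ (T : ℕ) at hinv₁
  change pull Φ (Base F (frob hF X.obj (E * T))) (invDiv F (Level.lift _ _ h₂T R₂) hR₂T.2) =
    pull Φ (Base F (frob hF X.obj E)) (invDiv F R₂ hR₂.2) ^ (T : ℕ) at hinv₂
  rw [← hinv₁, ← hinv₂] at hT
  have hT' := dvd_of_pull_frob_dvd hT
  -- STEP 4: Def. 1.3 (iii)(d) of `C` at `A^{(E·T)}` (sources isotropic)
  have hS₁ : IsCoAngularPreStep F (Level.lift (⟨S₁, E, hE₁⟩ : Level Y X) ⟨S₁ * T, E * T, hET₁⟩ h₁T R₁) :=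
    isCoAngularPreStep_of_isPreStep_frobPow hφ₁ hB₁' (hd₁.mul_right T) hR₁T
  have hS₂ : IsCoAngularPreStep F (Level.lift (⟨S₂, E, hE₂⟩ : Level Y' X) ⟨S₂ * T, E * T, hET₂⟩ h₂T R₂) :=
    isCoAngularPreStep_of_isPreStep_frobPow hφ₂ hB₂' (hd₂.mul_right T) hR₂T
  obtain ⟨g₀, hg₀, hcomp⟩ := hF.iii_d_over_full _ _ hS₁ hS₂ hT'
  -- STEP 5: the class of `g₀` at the level `(S₁·T, S₂·T)`
  have hY : Y.idx * (S₁ * T) = Y'.idx * (S₂ * T) := hET₁.trans hET₂.symm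
  have hgpre : (ops hF).IsPreStep (Hom.mk (⟨⟨S₁ * T, S₂ * T, hY⟩, g₀⟩ : Rep Y Y') : Y ⟶ Y') :=
    (isPreStep_mk_iff (⟨⟨S₁ * T, S₂ * T, hY⟩, g₀⟩ : Rep Y Y')).mpr hg₀.2
  refine ⟨Hom.mk ⟨⟨S₁ * T, S₂ * T, hY⟩, g₀⟩,
    ⟨(PreFrobenioidData.ofFunctor_isCoAngular (ops hF).toFunctor _).mp (isCoAngular_of_frobeniusIsotropic hiso _),
      (PreFrobenioidData.isPreStep_toFunctor_iff (ops hF) _).mpr hgpre⟩, ?_⟩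
  rw [← Hom.mk_lift (⟨⟨S₁, E, hE₁⟩, R₁⟩ : Rep Y X) ⟨S₁ * T, E * T, hET₁⟩ h₁T,
    ← Hom.mk_lift (⟨⟨S₂, E, hE₂⟩, R₂⟩ : Rep Y' X) ⟨S₂ * T, E * T, hET₂⟩ h₂T]
  rw [mk_comp_mk_aligned]
  exact congrArg (fun k => Hom.mk (⟨⟨S₁ * T, E * T, hET₁⟩, k⟩ : Rep Y X)) hcomp

end Perfection

end PreFrobenioid

end Literature.AlgebraicGeometry.Frobenioids
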